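import Literature.MathematicalPhysics.QuantumFieldTheory.Balaban1983to89.B8Prop6CubeMemberScalarGammaHolds
import Literature.MathematicalPhysics.QuantumFieldTheory.Balaban1983to89.Node00.CarriersB8CubePrint

/-!
# `Balaban1983to89.B8Prop6PrintedZdCubPGamma` — [Balaban1985RegularSpaces] PROPOSITION 6 (p. 99) AS PRINTED, AT THE FAMILY LEVEL, ON PRINT'S p. 98
# CUBE CLASS `zdCubP 𝔸 L ρ₀`: `B8.Prop6Printed d L B₁ c₁ (zdCubP 𝔸 L ρ₀ ∘ f)` for EVERY `d ≥ 2`, odd `L ≥ 5`, coefficient algebra `𝔸`, index map `f` —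
# UNCONDITIONAL; and the record-facing form over NODE 00's `θ : Stage3Params`

statement-level skeleton of published theorems with citation tags; proofs where landed; nothing here is a claim about the
Yang–Mills mass gap

PDF held: `paper:balaban1985-cmp99-regular-spaces-gauge-fixing`; Prop. 6 p. 99 ((1.135)–(1.138)), p. 98 (the cubes of Prop. 6: «a union of cubes of the size
R₁M₁Lʲη, where R₁, M₁ are smallest integers for which all the theorems of the papers [2, 4] are valid … M is a multiple of R₁M₁ … a distance between boundaries
of these cubes is equal to R₁M₁Lʲη … for every j the cube □_j is a sum of the big blocks of the lattice T_{L^{−j}}»).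

CITATION HEADER (lean-in-tree rule).  Cell `pub-ymgap` (HUMAN RULING D-0062, Track A), DAG node N05 = [B8], seat `pub-ymgap-dag-n05-e` g11 (R141 (C) row s3b —
Proposition 6's cube road; the record-facing twin named in the g10 HANDOFF (t2)).  WHY THIS FILE.  The flat line γ ends (Fγ11, p594960,
`B8Prop6CubeMemberScalarGammaHolds.gaugedBoundB8_cubeMember_scalar_γ_holds`) with Proposition 6's conclusion `GaugedBoundB8 L η U₀ c (7dL²·5dLB₀·Mα₀)` at
EVERY SINGLE CUBE `c : CubeB8 d L K Ω` whose datum lies on print's big-block sub-lattice above threshold — a per-cube letter.  The N05 record reads Proposition 6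
as the FAMILY-LEVEL sentence `B8.Prop6Printed θ.D θ.L lam.B₁ lam.c₁ lam.cub` (`Node00.ResidB8`, `PrintedCarriersR.withB8OfRecord`), and the print-faithful
family is k0-s2-w2's cut member `Node00.zdCubP 𝔸 L ρ₀` ((b1), `Node00/CarriersB8CubePrint`, cubes `{c // c.IsPrint ρ₀}`: `ρ₀ ∣ ρ`, `ρ₀ ∣ M`, corner on the
`ρ₀`-grid).  The K0 route has the `d = 4`, `𝔸 = M₂(ℂ)`, `F : T4Family` instance (k0-s2-w1 `K0Stub2PrimeJunction` ∕ `K0Stub2PrimeHolds` p593845, k0-s2-w2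
`K0Stub2PrimePrintSentence.prop6Printed_zdCubP_holds_family` p594661) in the `Summit.…` namespace, which Literature-side N05 knits cannot import and which does
not cover general `θ.D`, `θ.𝔸`.  THIS FILE is the general, Literature-side form: §1 the arithmetic choice of the big-block size from a letter's thresholds
(general-`L` ports of k0-s2-w1's two K0-namespace lemmas), §2 the supplier-agnostic JUNCTIONS per-cube letter ⇒ family sentence on `zdCubP` (general `d`, `𝔸`,
`L`, same `(B₁, c₁)`), §3 ★★★ `prop6Printed_zdCubP_γ_holds` — the family sentence UNCONDITIONALLY for `d ≥ 2`, odd `L ≥ 5` (Fγ11 ∘ §2), with print's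
«B₁ = 5dLB₀» visible, plus the `B₁ > 0` and «WLOG `t ∣ ρ₀`» forms, §4 the record-facing forms over `θ : Node00.Stage3Params` (`L` odd from `θ.hL`; every index
map, and the instance `IdxB8 θ → ZdIdx θ.D θ.L`, `i ↦ i.1` = what a print-class cube slot `i ↦ zdCubP θ.𝔸 θ.L ρ₀ i.1` reads; ★★ `p6_residB8_of_zdCubP` — the
`p6` conjunct `B8.Prop6Printed θ.D θ.L lam.B₁ lam.c₁ lam.cub` of n05-w1's record slot `Node00.B8LeafOfRecordSubBP θ lam` DISCHARGED at every residual layer `lam`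
whose cube members are print-class cubes `zdCubP θ.𝔸 θ.L ρ₀ ∘ g` and whose constants dominate `(B₁⋆, c₁⋆)`).  Kind «kernel-checked proof»; theorems only, no `def`.

HONEST SCOPE ∕ A6.  By-name composition of LANDED theorems; the analytic content is dag-n05-c's transplant T4 (`ineq159FlatCubeMemberPrinted_holds`, on
lit-balaban's torus-with-level-0 [B8] Prop. 3 chain) and this seat's flat line γ (Fγ1–Fγ11), both already in the tree with standard axioms.  WHAT IS PROVED is
the TREE's sentence `B8.Prop6Printed … (zdCubP …)` = `GaugedBoundB8` at every print cube under `InAk` and «7dL²Mα₀ ≤ c₁» (`Node00.prop6Printed_zdCubP_iff`);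
whether NODE 00's letters `GaugedBoundB8` ∕ `InAk` ∕ `CubeB8.IsPrint` carry the full content of print's (1.135)–(1.138) and p. 98 is the carriers' LOCATED question
of record (referees' call).  NOT PROVED ∕ NOT CLAIMED: Proposition 6 over ALL `CubeB8` cubes (`zdCub`; thin collars `ρ = L` — beyond print's class); anything for even
`L` or `L = 3` (the transplant's V1 torus reading is odd `L ≥ 5`); anything about N05's other slots (Lemma 1, Thm 2, Props 3∕5∕7, Thms 4∕8); the record pin
`cubB8OfRecordP` itself (a definition — k0-s2-w2 ∕ node00-def-T ∕ n05-d's act, not this file's).  N05 NOT discharged by this file; count-neutral until a referee's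
act-(iv) read and the chair's word; one finite `𝕋⁴` programme at fixed `ε`, Bałaban as printed; nothing continuum ∕ ℝ⁴ ∕ OS ∕ mass-gap ∕ Clay.  No `sorry`, no
`def`, no `instance`, no `notation`; standard axioms; default heartbeats.  Unit `pub-ymgap-dag-n05-e` (g11), 2026-08-28.
-/

noncomputable section

open NormedSpace

namespace Literature.MathematicalPhysics.QuantumFieldTheory.Balaban1983to89.B8Prop6PrintedZdCubPGamma

open B7Prop1Explicit B7Prop2Explicit
open B8LeafModelZd (ZdIdx)
open B8Ineq132 (InAk)
open B8Prop6CubeMemberScalarGammaHolds (gaugedBoundB8_cubeMember_scalar_γ_holds)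
open Node00 (CubeB8 GaugedBoundB8 zdCubP prop6Printed_zdCubP_iff prop6Printed_zdCubP_anti prop6Printed_zdCubP_mono Stage3Params IdxB8)

/-! ## §1  Choosing the big-block size `ρ₀ = R₁M₁` from a per-cube letter's thresholds (arithmetic) -/

/-- **A BIG-BLOCK SIZE MEETING ALL OF PRINT'S p. 98 THRESHOLDS EXISTS** (`L ≥ 1`; the `Mh`-shape of the flat line's printed letters): `Mh := max 3 ⌈M₀⌉₊`,
`R := max (2L) (N₀ + 1)`, `ρ₀ := (Mh·L)·(R·max 1 ⌈ρ₀′⌉₊)`.  Elementary arithmetic (general-`L` port of k0-s2-w1's K0-namespace lemma of the same name); print's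
«R₁, M₁ are smallest integers for which all the theorems of the papers [2, 4] are valid» — here any integers above the thresholds.
[cite: Balaban1985RegularSpaces, p.98 («M is a multiple of R₁M₁ … distance … equal to R₁M₁Lʲη»)] -/
theorem exists_bigBlock_of_thresholds {L : ℕ} (hL : 1 ≤ L) (M₀ ρ₀' : ℝ) (N₀ : ℕ) :
    ∃ ρ₀ Mh R : ℕ, 1 ≤ ρ₀ ∧ 3 ≤ Mh ∧ M₀ ≤ (L : ℝ) * Mh ∧ Mh * L ∣ ρ₀ ∧ R * (Mh * L) ≤ ρ₀ ∧ 2 * L ≤ R ∧ N₀ + 1 ≤ R * (L * Mh) ∧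
      ρ₀' ≤ (ρ₀ : ℝ) := by
  set Mh : ℕ := max 3 ⌈M₀⌉₊ with hMh
  set R : ℕ := max (2 * L) (N₀ + 1) with hR
  set t : ℕ := max 1 ⌈ρ₀'⌉₊ with ht
  have hMh3 : 3 ≤ Mh := le_max_left _ _
  have hR2 : 2 * L ≤ R := le_max_left _ _
  have hRN : N₀ + 1 ≤ R := le_max_right _ _
  have ht1 : 1 ≤ t := le_max_left _ _
  have hMhL : 1 ≤ Mh * L := Nat.one_le_iff_ne_zero.2 (Nat.mul_ne_zero (by omega) (by omega))
  have hR1 : 1 ≤ R := le_trans (by omega) hR2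
  refine ⟨Mh * L * (R * t), Mh, R, ?_, hMh3, ?_, Dvd.intro _ rfl, ?_, hR2, ?_, ?_⟩
  · exact Nat.one_le_iff_ne_zero.2 (Nat.mul_ne_zero (by omega) (Nat.mul_ne_zero (by omega) (by omega)))
  · have h1 : M₀ ≤ ⌈M₀⌉₊ := Nat.le_ceil M₀
    have h2 : (⌈M₀⌉₊ : ℝ) ≤ Mh := by exact_mod_cast le_max_right 3 ⌈M₀⌉₊
    have h3 : (Mh : ℝ) ≤ (L : ℝ) * Mh := le_mul_of_one_le_left (Nat.cast_nonneg _) (by exact_mod_cast hL)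
    linarith
  · calc R * (Mh * L) = Mh * L * (R * 1) := by ring
      _ ≤ Mh * L * (R * t) := Nat.mul_le_mul_left _ (Nat.mul_le_mul_left _ ht1)
  · calc N₀ + 1 ≤ R := hRN
      _ = R * 1 := (mul_one _).symm
      _ ≤ R * (L * Mh) := Nat.mul_le_mul_left _ (by rw [mul_comm]; exact hMhL)
  · have h1 : ρ₀' ≤ ⌈ρ₀'⌉₊ := Nat.le_ceil ρ₀'
    have h2 : (⌈ρ₀'⌉₊ : ℝ) ≤ t := by exact_mod_cast le_max_right 1 ⌈ρ₀'⌉₊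
    have h3 : (t : ℝ) ≤ ((Mh * L * (R * t) : ℕ) : ℝ) := by
      have : t ≤ Mh * L * (R * t) := by
        calc t = 1 * (1 * t) := by ring
          _ ≤ Mh * L * (R * t) := Nat.mul_le_mul hMhL (Nat.mul_le_mul_right _ hR1)
      exact_mod_cast this
    linarith

/-- **A POWER-OF-`L` BIG BLOCK MEETING THE NAMED FACT's THRESHOLDS EXISTS** (`L ≥ 2`; the `Lˢ`-shape of Fγ10b ∕ Fγ11 and of dag-n05-c's
`Ineq159FlatCubeMemberPrinted`): `s := max 2 ⌈M₀⌉₊` (so `3 ≤ Lˢ`, `M₀ ≤ Lˢ ≤ L^{s+1}`), `R := max (2L) (max R₀ (N₀ + 1))`, `ρ₀ := L^{s+1}·(R·max 1 ⌈ρ₀′⌉₊)`.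
Elementary arithmetic (general-`L` port of k0-s2-w1's K0-namespace lemma of the same name).
[cite: Balaban1985RegularSpaces, p.98 («M is a multiple of R₁M₁ … distance … equal to R₁M₁Lʲη»)] -/
theorem exists_powBlock_of_thresholds {L : ℕ} (hL : 2 ≤ L) (M₀ ρ₀' : ℝ) (N₀ R₀ : ℕ) :
    ∃ ρ₀ s R : ℕ, 1 ≤ ρ₀ ∧ 3 ≤ L ^ s ∧ M₀ ≤ (L : ℝ) ^ (s + 1) ∧ L ^ (s + 1) ∣ ρ₀ ∧ R * L ^ (s + 1) ≤ ρ₀ ∧ 2 * L ≤ R ∧ R₀ ≤ R ∧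
      N₀ + 1 ≤ R * L ^ (s + 1) ∧ ρ₀' ≤ (ρ₀ : ℝ) := by
  set s : ℕ := max 2 ⌈M₀⌉₊ with hs
  set R : ℕ := max (2 * L) (max R₀ (N₀ + 1)) with hR
  set t : ℕ := max 1 ⌈ρ₀'⌉₊ with ht
  have hs2 : 2 ≤ s := le_max_left _ _
  have hR2 : 2 * L ≤ R := le_max_left _ _
  have hRR : R₀ ≤ R := (le_max_left _ _).trans (le_max_right _ _)
  have hRN : N₀ + 1 ≤ R := (le_max_right _ _).trans (le_max_right _ _)
  have ht1 : 1 ≤ t := le_max_left _ _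
  have hL1 : 1 ≤ L := le_trans (by norm_num) hL
  have hLs1 : 1 ≤ L ^ (s + 1) := Nat.one_le_pow _ _ hL1
  have hR1 : 1 ≤ R := le_trans (by omega) hR2
  -- `Lˢ ≥ 2ˢ ≥ s + 1 ≥ 3` and `Lˢ ≥ s ≥ ⌈M₀⌉₊`
  have h2s : s + 1 ≤ 2 ^ s := Nat.succ_le_of_lt (Nat.lt_two_pow_self)
  have hLs : 2 ^ s ≤ L ^ s := Nat.pow_le_pow_left hL s
  have h3 : 3 ≤ L ^ s := by omega
  have hsM : ⌈M₀⌉₊ ≤ L ^ s := ((le_max_right 2 ⌈M₀⌉₊).trans (by omega : s ≤ 2 ^ s)).trans hLs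
  refine ⟨L ^ (s + 1) * (R * t), s, R, ?_, h3, ?_, Dvd.intro _ rfl, ?_, hR2, hRR, ?_, ?_⟩
  · exact Nat.one_le_iff_ne_zero.2 (Nat.mul_ne_zero (by omega) (Nat.mul_ne_zero (by omega) (by omega)))
  · have h1 : M₀ ≤ ⌈M₀⌉₊ := Nat.le_ceil M₀
    have h2 : (⌈M₀⌉₊ : ℝ) ≤ ((L ^ s : ℕ) : ℝ) := by exact_mod_cast hsM
    have h3 : ((L ^ s : ℕ) : ℝ) ≤ (L : ℝ) ^ (s + 1) := by
      rw [Nat.cast_pow, pow_succ]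
      exact le_mul_of_one_le_right (by positivity) (by exact_mod_cast hL1)
    linarith
  · calc R * L ^ (s + 1) = L ^ (s + 1) * (R * 1) := by ring
      _ ≤ L ^ (s + 1) * (R * t) := Nat.mul_le_mul_left _ (Nat.mul_le_mul_left _ ht1)
  · calc N₀ + 1 ≤ R := hRN
      _ = R * 1 := (mul_one _).symm
      _ ≤ R * L ^ (s + 1) := Nat.mul_le_mul_left _ hLs1
  · have h1 : ρ₀' ≤ ⌈ρ₀'⌉₊ := Nat.le_ceil ρ₀'
    have h2 : (⌈ρ₀'⌉₊ : ℝ) ≤ t := by exact_mod_cast le_max_right 1 ⌈ρ₀'⌉₊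
    have h3 : (t : ℝ) ≤ ((L ^ (s + 1) * (R * t) : ℕ) : ℝ) := by
      have : t ≤ L ^ (s + 1) * (R * t) := by
        calc t = 1 * (1 * t) := by ring
          _ ≤ L ^ (s + 1) * (R * t) := Nat.mul_le_mul hLs1 (Nat.mul_le_mul_right _ hR1)
      exact_mod_cast this
    linarith

/-! ## §2  ★ The junctions: a per-cube Proposition-6 letter above print's thresholds gives the family sentence on `zdCubP` (general `d`, `𝔸`, `L`) -/

section Junction

variable {d : ℕ} {𝔸 : Type} [CStarAlgebra 𝔸] {L : ℕ}

/-- ★ **THE FAMILY SENTENCE ON PRINT'S CLASS FROM A PER-CUBE PROPOSITION-6 LETTER OF THE `Mh`-SHAPE** (the flat line's printed letters, e.g. Fγ9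
`gaugedBoundB8_cubeMember_scalar_γ_printed`; general `d`, `𝔸`, `L ≥ 1`, SAME `(B₁, c₁)`): choose the big-block size `ρ₀` from the letter's thresholds
`(ρ₀′, M₀, N₀)` (§1); every print cube `c` at `ρ₀` meets the letter's binders `Mh·L ∣ c.ρ`, `Mh·L ∣ c.M`, `R·(Mh·L) ≤ c.ρ`, `ρ₀′ ≤ c.ρ` (k0-s2-w2's
`CubeB8.IsPrint.sideConditions_of_dvd`), so the letter gives `GaugedBoundB8` at `c` for every index `j : ι` — i.e. `B8.Prop6Printed d L B₁ c₁` on `zdCubP 𝔸 L ρ₀ ∘ f`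
(`Node00.prop6Printed_zdCubP_iff`).  Supplier-agnostic.
[cite: Balaban1985RegularSpaces, Prop. 6 (1.135)–(1.138) p.99, p.98 («R₁, M₁ … M is a multiple of R₁M₁ … distance … R₁M₁Lʲη … □_j is a sum of the big blocks»)] -/
theorem prop6Printed_zdCubP_of_perCubeLetter (hL : 1 ≤ L) {B₁ c₁ ρ₀' M₀ : ℝ} {N₀ : ℕ}
    (G : ∀ (η : ℝ), 0 < η → ∀ {K : ℕ} {Ω : ℕ → Set (B7Prop1Explicit.Site d)} (c : CubeB8 d L K Ω),
        ∀ (Mh R : ℕ), 3 ≤ Mh → M₀ ≤ (L : ℝ) * Mh → Mh * L ∣ c.ρ → Mh * L ∣ c.M → R * (Mh * L) ≤ c.ρ → 2 * L ≤ R →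
          N₀ + 1 ≤ R * (L * Mh) → ρ₀' ≤ (c.ρ : ℝ) →
        ∀ (U₀ : B7Prop1Explicit.Site d → Fin d → 𝔸ˣ), (∀ x κ, U₀ x κ ∈ unitaryUnits 𝔸) → ∀ (α₀ : ℝ), 0 < α₀ → InAk L K η α₀ Ω U₀ →
        7 * d * (L : ℝ) ^ 2 * c.M * α₀ ≤ c₁ →
        GaugedBoundB8 L η U₀ c (7 * d * (L : ℝ) ^ 2 * B₁ * c.M * α₀)) :
    ∃ ρ₀ : ℕ, 1 ≤ ρ₀ ∧ ∀ {ι : Type} (f : ι → ZdIdx d L), B8.Prop6Printed d (L : ℝ) B₁ c₁ (fun j => zdCubP 𝔸 L ρ₀ (f j)) := by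
  obtain ⟨ρ₀, Mh, R, hρ₀, hMh, hM₀, hdvd, hR, h2L, hN₀, hρ₀'⟩ := exists_bigBlock_of_thresholds hL M₀ ρ₀' N₀
  refine ⟨ρ₀, hρ₀, fun f => ?_⟩
  rw [prop6Printed_zdCubP_iff]
  intro j α₀ hα U₀ hInA c hc hs
  obtain ⟨h1, h2, h3, h4⟩ := hc.sideConditions_of_dvd hL hdvd hR hρ₀'
  exact G (f j).η (f j).hη c Mh R hMh hM₀ h1 h2 h3 h2L hN₀ h4 U₀.1 U₀.2 α₀ hα hInA hs

/-- ★ **THE FAMILY SENTENCE ON PRINT'S CLASS FROM A PER-CUBE PROPOSITION-6 LETTER OF THE NAMED FACT's `Lˢ`-SHAPE** (big blocks `M_h = Lˢ`, extra threshold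
`R₀ ≤ R` — the shape of Fγ10b ∕ Fγ11; general `d`, `𝔸`, `L ≥ 2`, SAME `(B₁, c₁)`): `ρ₀` from `exists_powBlock_of_thresholds`; every print cube at `ρ₀` meets the
letter's binders (`CubeB8.IsPrint.sideConditions_of_dvd` at `Mh := Lˢ`); `Node00.prop6Printed_zdCubP_iff`.  Supplier-agnostic.
[cite: Balaban1985RegularSpaces, Prop. 6 (1.135)–(1.138) p.99, p.98] -/
theorem prop6Printed_zdCubP_of_perCubeLetterPow (hL : 2 ≤ L) {B₁ c₁ ρ₀' M₀ : ℝ} {N₀ R₀ : ℕ}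
    (G : ∀ (η : ℝ), 0 < η → ∀ {K : ℕ} {Ω : ℕ → Set (B7Prop1Explicit.Site d)} (c : CubeB8 d L K Ω),
        ∀ (s R : ℕ), 3 ≤ L ^ s → M₀ ≤ (L : ℝ) ^ (s + 1) → L ^ (s + 1) ∣ c.ρ → L ^ (s + 1) ∣ c.M → R * L ^ (s + 1) ≤ c.ρ → 2 * L ≤ R →
          R₀ ≤ R → N₀ + 1 ≤ R * L ^ (s + 1) → ρ₀' ≤ (c.ρ : ℝ) →
        ∀ (U₀ : B7Prop1Explicit.Site d → Fin d → 𝔸ˣ), (∀ x κ, U₀ x κ ∈ unitaryUnits 𝔸) → ∀ (α₀ : ℝ), 0 < α₀ → InAk L K η α₀ Ω U₀ →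
        7 * d * (L : ℝ) ^ 2 * c.M * α₀ ≤ c₁ →
        GaugedBoundB8 L η U₀ c (7 * d * (L : ℝ) ^ 2 * B₁ * c.M * α₀)) :
    ∃ ρ₀ : ℕ, 1 ≤ ρ₀ ∧ ∀ {ι : Type} (f : ι → ZdIdx d L), B8.Prop6Printed d (L : ℝ) B₁ c₁ (fun j => zdCubP 𝔸 L ρ₀ (f j)) := by
  have hL1 : 1 ≤ L := le_trans (by norm_num) hL
  obtain ⟨ρ₀, s, R, hρ₀, h3, hM₀, hdvd, hR, h2L, hR₀, hN₀, hρ₀'⟩ := exists_powBlock_of_thresholds hL M₀ ρ₀' N₀ R₀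
  refine ⟨ρ₀, hρ₀, fun f => ?_⟩
  rw [prop6Printed_zdCubP_iff]
  intro j α₀ hα U₀ hInA c hc hs
  -- the letter's `Mh·L` is `Lˢ·L = L^{s+1}`
  have hdvd' : L ^ s * L ∣ ρ₀ := by rw [← pow_succ]; exact hdvd
  have hR' : R * (L ^ s * L) ≤ ρ₀ := by rw [← pow_succ]; exact hR
  obtain ⟨h1, h2, h3', h4⟩ := hc.sideConditions_of_dvd hL1 hdvd' hR' hρ₀'
  rw [← pow_succ] at h1 h2 h3'
  exact G (f j).η (f j).hη c s R h3 hM₀ h1 h2 h3' h2L hR₀ hN₀ h4 U₀.1 U₀.2 α₀ hα hInA hs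

end Junction

/-! ## §3  ★★★ Proposition 6 as printed on print's class, family level — UNCONDITIONAL (`d ≥ 2`, odd `L ≥ 5`) -/

section Holds

variable {d : ℕ} {𝔸 : Type} [CStarAlgebra 𝔸] [Nontrivial 𝔸]

/-- ★★★ **[B8] PROPOSITION 6 AS PRINTED, ON PRINT'S p. 98 CUBE CLASS, AT THE FAMILY LEVEL — UNCONDITIONAL** (`d ≥ 2`, `L ≥ 5` odd; every coefficient
C⋆-algebra `𝔸`, every index type `ι` and index map `f`).  There are a big-block size `ρ₀ ≥ 1` (print's `R₁M₁`), `B₀ ≥ 1` and `c₁ > 0` — functions of `d, L`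
only — such that `B8.Prop6Printed d L (5dLB₀) c₁ (zdCubP 𝔸 L ρ₀ ∘ f)`: for every index `j`, every `α₀ > 0`, every unitary `U₀ ∈ 𝔄_k({Ω_j}, α₀)` and every
PRINT cube `c` at `ρ₀` with «7dL²Mα₀ ≤ c₁», «there exists a gauge transformation u defined on □̃ such that U₀^{u⁻¹} = e^{iηA} on □̃ (1.135), Lʲη|A|,
(Lʲη)²|∇^η A|, (Lʲη)³|∂^{η*}∂^η A|, (Lʲη)³|Δ^η A| ≤ 7dL²B₁Mα₀ on □_j, B₁ = 5dLB₀ (1.136), Q_k(ηA) = (1∕i) log Ū₀′ᵏ (1.137), R∂*A = 0 (1.138)»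
(`GaugedBoundB8`).  PROOF: Fγ11 `gaugedBoundB8_cubeMember_scalar_γ_holds` (the per-cube letter, unconditional) ∘ §2 `prop6Printed_zdCubP_of_perCubeLetterPow`.
[cite: Balaban1985RegularSpaces, Prop. 6 (1.135)–(1.138) p.99, p.98 («R₁, M₁ are smallest integers for which all the theorems of the papers [2, 4] are valid … M is a multiple of R₁M₁»), Thm 4 (1.68) p.88 («B₁ = 5dLB₀»)] -/
theorem prop6Printed_zdCubP_γ_holds (hd2 : 2 ≤ d) {L : ℕ} (hL5 : 5 ≤ L) (hodd : Odd L) :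
    ∃ ρ₀ : ℕ, ∃ B₀ c₁ : ℝ, 1 ≤ ρ₀ ∧ 1 ≤ B₀ ∧ 0 < c₁ ∧
      ∀ {ι : Type} (f : ι → ZdIdx d L), B8.Prop6Printed d (L : ℝ) (5 * (d : ℝ) * L * B₀) c₁ (fun j => zdCubP 𝔸 L ρ₀ (f j)) := by
  have hL2 : 2 ≤ L := le_trans (by norm_num) hL5
  obtain ⟨B₀, c₁, ρ₀', M₀, N₀, R₀, hB₀, hc₁, G⟩ := gaugedBoundB8_cubeMember_scalar_γ_holds (𝔸 := 𝔸) hd2 hL5 hodd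
  obtain ⟨ρ₀, hρ₀, H⟩ := prop6Printed_zdCubP_of_perCubeLetterPow (𝔸 := 𝔸) (B₁ := 5 * (d : ℝ) * L * B₀) (c₁ := c₁) hL2
    (fun η hη K Ω c s R h3 hM₀ h1 h2 h3' h2L hR₀ hN₀ h4 U₀ hU α₀ hα hInA hs => by
      have := G η hη c s R h3 hM₀ h1 h2 h3' h2L hR₀ hN₀ h4 U₀ hU α₀ hα hInA hs
      simpa only [mul_assoc] using this)
  exact ⟨ρ₀, B₀, c₁, hρ₀, hB₀, hc₁, fun f => H f⟩

/-- ★★ **[B8] PROPOSITION 6 AS PRINTED ON PRINT'S CLASS, FAMILY LEVEL, WITH A POSITIVE CONSTANT `B₁ > 0`** (`d ≥ 2`, `L ≥ 5` odd): the `∃ ρ₀ B₁ c₁` form the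
record's residual layer reads (`lam.B₁`, `lam.c₁`).  From `prop6Printed_zdCubP_γ_holds` with `B₁ := 5dLB₀ ≥ 5dL > 0`.
[cite: Balaban1985RegularSpaces, Prop. 6 (1.135)–(1.138) p.99, p.98] -/
theorem prop6Printed_zdCubP_γ_holds_pos (hd2 : 2 ≤ d) {L : ℕ} (hL5 : 5 ≤ L) (hodd : Odd L) :
    ∃ ρ₀ : ℕ, ∃ B₁ c₁ : ℝ, 1 ≤ ρ₀ ∧ 0 < B₁ ∧ 0 < c₁ ∧
      ∀ {ι : Type} (f : ι → ZdIdx d L), B8.Prop6Printed d (L : ℝ) B₁ c₁ (fun j => zdCubP 𝔸 L ρ₀ (f j)) := by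
  obtain ⟨ρ₀, B₀, c₁, hρ₀, hB₀, hc₁, H⟩ := prop6Printed_zdCubP_γ_holds (𝔸 := 𝔸) hd2 hL5 hodd
  refine ⟨ρ₀, 5 * (d : ℝ) * L * B₀, c₁, hρ₀, ?_, hc₁, fun f => H f⟩
  have hd : (0 : ℝ) < d := by exact_mod_cast (lt_of_lt_of_le (by norm_num) hd2)
  have hL : (0 : ℝ) < L := by exact_mod_cast (lt_of_lt_of_le (by norm_num) hL5)
  have hB : (0 : ℝ) < B₀ := lt_of_lt_of_le one_pos hB₀
  positivity

/-- **WLOG THE BIG BLOCK IS A MULTIPLE OF ANY GIVEN `t ≥ 1`** (`d ≥ 2`, `L ≥ 5` odd): Proposition 6 on the `ρ₀`-cubes gives it on the `ρ₀·t`-cubes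
(`Node00.prop6Printed_zdCubP_anti`, every `ρ₀t`-cube is a `ρ₀`-cube) — for consumers whose own lattice of blocks wants `t ∣ ρ₀` (e.g. `t = L^j`).
[cite: Balaban1985RegularSpaces, Prop. 6 p.99, p.98 («M is a multiple of R₁M₁»)] -/
theorem prop6Printed_zdCubP_γ_holds_dvd (hd2 : 2 ≤ d) {L : ℕ} (hL5 : 5 ≤ L) (hodd : Odd L) {t : ℕ} (ht : 1 ≤ t) :
    ∃ ρ₀ : ℕ, ∃ B₁ c₁ : ℝ, 1 ≤ ρ₀ ∧ t ∣ ρ₀ ∧ 0 < B₁ ∧ 0 < c₁ ∧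
      ∀ {ι : Type} (f : ι → ZdIdx d L), B8.Prop6Printed d (L : ℝ) B₁ c₁ (fun j => zdCubP 𝔸 L ρ₀ (f j)) := by
  obtain ⟨ρ₀, B₁, c₁, hρ₀, hB₁, hc₁, H⟩ := prop6Printed_zdCubP_γ_holds_pos (𝔸 := 𝔸) hd2 hL5 hodd
  refine ⟨ρ₀ * t, B₁, c₁, ?_, Dvd.intro_left _ rfl, hB₁, hc₁, fun f => prop6Printed_zdCubP_anti f (Dvd.intro _ rfl) (H f)⟩
  exact Nat.one_le_iff_ne_zero.2 (Nat.mul_ne_zero (by omega) (by omega))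

end Holds

/-! ## §4  ★★ The record-facing forms over NODE 00's `θ : Stage3Params` (the `p6` conjunct of the N05 ∃λ closers) -/

section Record

variable (θ : Stage3Params)

/-- ★★ **[B8] PROPOSITION 6 AS PRINTED ON PRINT'S CLASS FOR THE STAGE-3 DATUM OF RECORD `θ`** (`θ.D ≥ 2`, `θ.L ≥ 5`; `θ.L` odd by `θ.hL`): there are `ρ₀ ≥ 1`,
`B₁ > 0`, `c₁ > 0` such that for EVERY index map `f : ι → ZdIdx θ.D θ.L` (the admitted index `IdxB8 θ`, the law sub-families `IdxB8Sub θ` ∕ `IdxB8SubB θ`, a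
cube member, …) `B8.Prop6Printed θ.D θ.L B₁ c₁ (fun j => zdCubP θ.𝔸 θ.L ρ₀ (f j))`.  This is the `p6` conjunct `B8.Prop6Printed θ.D θ.L lam.B₁ lam.c₁ lam.cub` of
`PrintedCarriersR.withB8OfRecord θ lam` for every residual layer `lam : Node00.ResidB8 θ` naming `cub := fun i => zdCubP θ.𝔸 θ.L ρ₀ (f i)`, `B₁`, `c₁` —
discharged by `obtain`.  = §3 `prop6Printed_zdCubP_γ_holds_pos` at `(θ.D, θ.L, θ.𝔸)`.
[cite: Balaban1985RegularSpaces, Prop. 6 (1.135)–(1.138) p.99, p.98] -/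
theorem prop6Printed_zdCubP_γ_holds_record (hD : 2 ≤ θ.D) (hL5 : 5 ≤ θ.L) :
    ∃ ρ₀ : ℕ, ∃ B₁ c₁ : ℝ, 1 ≤ ρ₀ ∧ 0 < B₁ ∧ 0 < c₁ ∧
      ∀ {ι : Type} (f : ι → ZdIdx θ.D θ.L), B8.Prop6Printed θ.D (θ.L : ℝ) B₁ c₁ (fun j => zdCubP θ.𝔸 θ.L ρ₀ (f j)) :=
  prop6Printed_zdCubP_γ_holds_pos (𝔸 := θ.𝔸) hD hL5 θ.hL.1

/-- ★★ **THE SAME AT THE ADMITTED INDEX `IdxB8 θ` ITSELF** (`f := (·.1)`): `∃ ρ₀ B₁ c₁, 1 ≤ ρ₀ ∧ 0 < B₁ ∧ 0 < c₁ ∧ B8.Prop6Printed θ.D θ.L B₁ c₁ (fun i : IdxB8 θ =>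
zdCubP θ.𝔸 θ.L ρ₀ i.1)` — what a print-class cube slot of record `i ↦ zdCubP θ.𝔸 θ.L ρ₀ i.1` (k0-s2-w2's drafted `cubB8OfRecordP θ ρ₀`) reads, proved for every
admissible `θ` with `θ.L ≥ 5`.  [cite: Balaban1985RegularSpaces, Prop. 6 (1.135)–(1.138) p.99, p.98, p.77 («we admit Ω_j = T_η»)] -/
theorem prop6Printed_zdCubP_γ_holds_idxB8 (hD : 2 ≤ θ.D) (hL5 : 5 ≤ θ.L) :
    ∃ ρ₀ : ℕ, ∃ B₁ c₁ : ℝ, 1 ≤ ρ₀ ∧ 0 < B₁ ∧ 0 < c₁ ∧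
      B8.Prop6Printed θ.D (θ.L : ℝ) B₁ c₁ (fun i : IdxB8 θ => zdCubP θ.𝔸 θ.L ρ₀ i.1) := by
  obtain ⟨ρ₀, B₁, c₁, hρ₀, hB₁, hc₁, H⟩ := prop6Printed_zdCubP_γ_holds_record θ hD hL5
  exact ⟨ρ₀, B₁, c₁, hρ₀, hB₁, hc₁, H (fun i : IdxB8 θ => i.1)⟩

/-- **… AND WITH ANY LARGER `B₁′ ≥ B₁`, SMALLER `c₁′ ≤ c₁`, AND A BIG BLOCK DIVISIBLE BY ANY `t ≥ 1`** — the three dials a knit may need to align the `p6` slot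
with the other members' constants (`Node00.prop6Printed_zdCubP_mono` ∕ `_anti`).  [cite: Balaban1985RegularSpaces, Prop. 6 p.99, p.98 (bookkeeping)] -/
theorem prop6Printed_zdCubP_γ_holds_record_dvd (hD : 2 ≤ θ.D) (hL5 : 5 ≤ θ.L) {t : ℕ} (ht : 1 ≤ t) :
    ∃ ρ₀ : ℕ, ∃ B₁ c₁ : ℝ, 1 ≤ ρ₀ ∧ t ∣ ρ₀ ∧ 0 < B₁ ∧ 0 < c₁ ∧
      ∀ {ι : Type} (f : ι → ZdIdx θ.D θ.L) (B₁' c₁' : ℝ), B₁ ≤ B₁' → c₁' ≤ c₁ →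
        B8.Prop6Printed θ.D (θ.L : ℝ) B₁' c₁' (fun j => zdCubP θ.𝔸 θ.L ρ₀ (f j)) := by
  obtain ⟨ρ₀, B₁, c₁, hρ₀, hdvd, hB₁, hc₁, H⟩ := prop6Printed_zdCubP_γ_holds_dvd (𝔸 := θ.𝔸) hD hL5 θ.hL.1 ht
  exact ⟨ρ₀, B₁, c₁, hρ₀, hdvd, hB₁, hc₁, fun f B₁' c₁' hB hc => prop6Printed_zdCubP_mono f ρ₀ hB hc (H f)⟩

/-- ★★ **THE `p6` CONJUNCT OF THE N05 RECORD SLOT, DISCHARGED AT EVERY RESIDUAL LAYER WHOSE PROPOSITION-6 MEMBERS ARE PRINT-CLASS CUBES**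
(`θ.D ≥ 2`, `θ.L ≥ 5`; `t ≥ 1` any prescribed divisor of the big block): there are `ρ₀` (`t ∣ ρ₀`), `B₁⋆ > 0`, `c₁⋆ > 0` such that for EVERY `lam : Node00.ResidB8 θ`
whose cube members are `lam.cub = fun j => zdCubP θ.𝔸 θ.L ρ₀ (g j)` for SOME index map `g : lam.I8d → ZdIdx θ.D θ.L` (e.g. `I8d := IdxB8 θ`, `g := (·.1)` — k0-s2-w2's
drafted `lam.withCubP ρ₀`; or `I8d := IdxB8SubB θ`, `g := (·.1.1)`) and whose constants satisfy `B₁⋆ ≤ lam.B₁`, `lam.c₁ ≤ c₁⋆`, the conjunct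
`B8.Prop6Printed θ.D θ.L lam.B₁ lam.c₁ lam.cub` of `Node00.B8LeafOfRecordSubBP θ lam` (n05-w1's `b8LeafOfRecordSubBP_of_fields`, binder `p6`) ∕ of
`PrintedCarriersR.withB8OfRecord θ lam` HOLDS — the knit's `p6` is no longer a hypothesis at such a layer.
[cite: Balaban1985RegularSpaces, Prop. 6 (1.135)–(1.138) p.99, p.98] -/
theorem p6_residB8_of_zdCubP (hD : 2 ≤ θ.D) (hL5 : 5 ≤ θ.L) {t : ℕ} (ht : 1 ≤ t) :
    ∃ ρ₀ : ℕ, ∃ B₁ c₁ : ℝ, 1 ≤ ρ₀ ∧ t ∣ ρ₀ ∧ 0 < B₁ ∧ 0 < c₁ ∧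
      ∀ (lam : Node00.ResidB8 θ) (g : lam.I8d → ZdIdx θ.D θ.L), (lam.cub = fun j => zdCubP θ.𝔸 θ.L ρ₀ (g j)) →
        B₁ ≤ lam.B₁ → lam.c₁ ≤ c₁ → B8.Prop6Printed θ.D (θ.L : ℝ) lam.B₁ lam.c₁ lam.cub := by
  obtain ⟨ρ₀, B₁, c₁, hρ₀, hdvd, hB₁, hc₁, H⟩ := prop6Printed_zdCubP_γ_holds_record_dvd θ hD hL5 ht
  refine ⟨ρ₀, B₁, c₁, hρ₀, hdvd, hB₁, hc₁, fun lam g hcub hB hc => ?_⟩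
  rw [hcub]
  exact H g lam.B₁ lam.c₁ hB hc

end Record

#print axioms prop6Printed_zdCubP_γ_holds
#print axioms prop6Printed_zdCubP_γ_holds_record

end Literature.MathematicalPhysics.QuantumFieldTheory.Balaban1983to89.B8Prop6PrintedZdCubPGamma

end
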